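import Summits.BirchSwinnertonDyer.Rank1Residual.O5.SignedLevelRaisingTransferThree
import HarnessLib

/-!
# O5 at `p = 3`: the signed level-raising transfer — §6, ADDITIVE old primes are free (T-O5-JP §6, o5-r2 GEN 11; placed A-O5-JP0′, cc-typer-5 GEN 14, (c15′))

HONEST FRAMING (cell `b2b-bsdres`, class O5 = `9 ∥ N`, tame potentially supersingular, analytic rank `≤ 1`; lane
CLASS-CLOSURE, experiment types (2) obstruction anatomy and (3) transport lemmas; seat O5 PLANNER 2, the non-Iwasawa
side): research route; no claim beyond the stated classes; census numbers quoted in docstrings are EVIDENCE, never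
Literature facts; nothing here moves a RESIDUAL-MAP mark; O5 stays OPEN; no main conjecture is used.  Net named-fact
debt of this file: `0` (one helper `def` with a body, four `@[conjecture]` EVIDENCE nodes that assert nothing, three
PROVED bookkeeping theorems).

## What is here and why it is a separate file

This is §6 of o5-r2's node file `run/shared/lean/b2b/bsd-rank1-residual/b2b-bsdres-o5-r2/gen11/lean/
SignedLevelRaisingTransferThree.G11-append.lean` (sha16 `8dbc5af3a240a5cb`; ask A-O5-JP0′, INBOX 2026-08-22T07:28:53Z),
VERBATIM in names and statements.  §1–§3 of that file are the tree's `O5/SignedLevelRaisingTransferThree.lean` (p321085)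
and §4–§5 were appended to it (p322494); §6 would take that file past the 400-line lint, so it lives here and imports it.
The written census record behind §6 is `gen11/jpadd/JPCAL-A-RESULT.md` (sha16 `5020412a89c3d422`; pre-registration
`JPCAL-A-PREREG.md` `abe103982a930ed6` written before any run; engine `jpcal_budget3.py` `4f9e98f13c8b7283`; BSD-blind
local table kit job `j154898`).

* `placeOfNatPrime ℓ hℓ : HeightOneSpectrum ℤ` — the finite place under the rational prime `ℓ` (the tree's inline idiom
  `(Rat.HeightOneSpectrum.primesEquiv (R := ℤ)).symm ⟨ℓ, hℓ⟩`, named because four nodes use it; unfolding lemmas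
  `primesEquiv_placeOfNatPrime`, `primesEquiv_placeOfNatPrime_val`).  Not a duplicate: `Literature/…/SelmerGroupPID.lean`'s
  `placeOfPrime` is the place of a prime ELEMENT of `𝓞 K`, `AlbertTypesQuaternion.lean`'s constant is the single place `3`.
* `AdditiveTamagawaThreeInvariant` — `[3 ∣ c_ℓ(C)] = [3 ∣ c_ℓ(G)]` at a shared additive prime `ℓ ≠ 3` of a mod-3
  congruent pair (stated with the tree's `KunduRay2024.PDvdTamagawaAt`).  STATUS ⟦cc-typer-5 GEN 17, rider (r8) of cc-lead ⟦gen69⟧ (2′)⟧: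
  **THEOREM** — PROVED AS TYPED by harvest-2 GEN 56 (E110), `additiveTamagawaThreeInvariant_holds` (`O5/AdditiveTamagawaThreeInvariantHolds.lean`,
  p341228 ACCEPTED 08e5f63bbad7); its `@[conjecture]` attribute dropped below, statement bytes unchanged; the other three nodes untouched (`@[conjecture]` × 3).
* `AdditiveLocalRootNumberCongruenceInvariant` — `w_ℓ(C) = w_ℓ(G)` there (THEOREM-CANDIDATE at `ℓ ≥ 5`, GENUINE
  CONJECTURE at `ℓ = 2`; stated with the tree's `WeierstrassCurve.localRootNumberAt`).
* `AdditivePlacesFreeTransferThree` — the sharp signed law `SignedLevelRaisingTransferThreeSharp` (§2 of the node file)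
  with "no 3-transverse prime" RELAXED to "every 3-transverse prime `≠ q` on either side is an additive prime of `C`";
  PROVED edge `signedLevelRaisingTransferThreeSharp_of_additivePlacesFree` (the relaxation specialises back: with
  `transversePrimesThree C = ∅`, `transversePrimesThree G ⊆ {q}` the additivity hypothesis is vacuous).
* `AdditivePlacesFreeNonsplitThree` — level raising at one NON-split prime changes nothing, additive places allowed.

## Typer's notes (cc-typer-5 GEN 14)

* Scope binder.  o5-r2 inserted the typer's binder `(ClassO5 C 3 ∨ ¬ Addv C 3)` (p321085, Typer's notes there) on all
  four nodes; it is kept verbatim — unlike §4–§5 (which carry `3 ∤ N_C` and need none), §6 ranges over pairs that may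
  be additive at `3`, where the at-3 input is exactly the O5 one (`NoLocalThreeTorsionAt _ 3`, `rootNumberThree`).
* Vocabulary.  Everything resolves under the node file's imports (`HasAdditiveReductionAt` from
  `Literature/…/LocalReduction.lean`, `localRootNumberAt` from `Literature/…/RootNumber.lean` [cite: Rohrlich1994CRM, §19–20],
  `PDvdTamagawaAt` from `Literature/…/KunduRay2024/TamagawaGeneratorBound.lean`, `transversePrimesThree` /
  `FullLocalThreeTorsionAt` from `O5UncleanParity.lean`, `IsSplitNodeAt` from `O5TransferCertificate.lean`,
  `IsNonsplitNodeAt` / `LocallyThreeDivisibleAt` from the node file); no notion is re-declared.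
* Docstring numbers are o5-r2's, checked against the posted RESULT line (103 546 shared additive primes, 51 596 at
  `ℓ = 2`; A3w0 3 509 rows; cells 450 / 415 / 366 / 110; non-split 1 441); they are EVIDENCE labels, not hypotheses.
-/

noncomputable section

open scoped Classical

open WeierstrassCurve Literature.NumberTheory.EllipticCurves Literature.NumberTheory.EllipticCurves.Rank1Residual
  Summit.BirchSwinnertonDyer.Rank1Residual.Additive

namespace Summit.BirchSwinnertonDyer.Rank1Residual.O5

/-! ## §6 Additive old primes (census JPC3-CAL/A, same GEN; pre-registered `abe103982a930ed6`, engine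
`jpcal_budget3.py` `4f9e98f13c8b7283`, BSD-blind local table kit `j154898`; RESULT `gen11/jpadd/JPCAL-A-RESULT.md` sha16 `5020412a89c3d422`, INBOX 2026-08-22T07:28:53Z).  Population:
all 119 849 usable pairs (81 404 with a shared ADDITIVE prime).  At a shared additive prime `ℓ ≠ 3`, `C⁰(ℚ_ℓ)` is
uniquely 3-divisible, so `h⁰(ℚ_ℓ, ρ̄) = dim Φ_ℓ(𝔽_ℓ)[3] = [3 ∣ c_ℓ]` and `dim H¹(ℚ_ℓ, ρ̄) = 2 h⁰`: an additive prime
with `3 ∤ c_ℓ` carries NO local condition, one with `c_ℓ = 3` (Kodaira IV / IV* with rational components) is a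
1-in-2 place.  BSD-blind, 0 exceptions: `[3 ∣ c_ℓ(C)] = [3 ∣ c_ℓ(G)]` at all 103 546 shared additive primes (51 596 at
`ℓ = 2`) and — NOT predicted for the `c_ℓ = 3` places — the local root numbers agree at ALL of them (`w_ℓ(C) = w_ℓ(G)`,
103 546/103 546; Kodaira pairs at `c = 3`: (IV*,IV*) 1 153, (IV*,IV) 884, (IV,IV*) 960, (IV,IV) 541), so an additive
prime is NEVER a transfer place by root numbers; BSD side, 0 exceptions: parity `Δ ≡ k + F` and budget
`|Δ| ≤ k + F + 2·SH2` WITHOUT any additive term on all 81 382 scored non-semistable rows (3 509 of them with a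
`c_ℓ = 3` additive place), and the sharp signed law verbatim on the 70 373 rows whose old primes are all free
(69 298 singleton + 1 075 set), in particular on the 3 099 such rows with a shared `c_ℓ = 3` additive prime. -/

/-- The finite place of `ℤ` under the rational prime `ℓ`. [folklore] -/
def placeOfNatPrime (ℓ : ℕ) (hℓ : ℓ.Prime) : IsDedekindDomain.HeightOneSpectrum ℤ :=
  (Rat.HeightOneSpectrum.primesEquiv (R := ℤ)).symm ⟨ℓ, hℓ⟩

/-- `placeOfNatPrime ℓ hℓ` lies over `ℓ` (unfolding lemma: it is the inverse image of `⟨ℓ, hℓ⟩` under Mathlib's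
`Rat.HeightOneSpectrum.primesEquiv`, the tree's idiom `(primesEquiv (R := ℤ)).symm ⟨p, hp⟩`). [folklore] -/
@[simp] theorem primesEquiv_placeOfNatPrime (ℓ : ℕ) (hℓ : ℓ.Prime) :
    Rat.HeightOneSpectrum.primesEquiv (R := ℤ) (placeOfNatPrime ℓ hℓ) = ⟨ℓ, hℓ⟩ :=
  (Rat.HeightOneSpectrum.primesEquiv (R := ℤ)).apply_symm_apply _

/-- The rational prime under `placeOfNatPrime ℓ hℓ` is `ℓ` (the `(primesEquiv v : ℕ) = ℓ` form used by the X6 files). [folklore] -/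
theorem primesEquiv_placeOfNatPrime_val (ℓ : ℕ) (hℓ : ℓ.Prime) :
    ((Rat.HeightOneSpectrum.primesEquiv (R := ℤ) (placeOfNatPrime ℓ hℓ) : Nat.Primes) : ℕ) = ℓ := by
  rw [primesEquiv_placeOfNatPrime]

/-- **`AdditiveTamagawaThreeInvariant` — THEOREM: PROVED AS TYPED by harvest-2 GEN 56 E110, `additiveTamagawaThreeInvariant_holds` (`O5/AdditiveTamagawaThreeInvariantHolds.lean`,
p341228 ACCEPTED 08e5f63bbad7; unique 3-divisibility of `E₀(ℚ_ℓ)` at an additive `ℓ ≠ 3` (x11b3-p4 `Additive.CuspDivision`), additivity of `G` at `ℓ` from the conductor identity,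
and `C(ℚ_ℓ)[3] ≃ G(ℚ_ℓ)[3]` from E109's equivariant `C[3] ≃ G[3]`; binders verbatim incl. the scope binder and `ℓ = 2`; axioms standard); `@[conjecture]` DROPPED
⟦cc-typer-5 GEN 17, rider (r8)⟧, statement bytes unchanged; JPC3-CAL/A stays EVIDENCE; a `_holds` closes no pair; O5 OPEN.**  **(As typed: THEOREM-CANDIDATE; EVIDENCE: JPC3-CAL/A P0-A1, 103 546/103 546 shared additive
primes.)**  For `C`, `G` congruent mod 3 with irreducible `ρ̄`, `C` additive at `ℓ ≠ 3`, same conductor exponent at `ℓ`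
(`N_G = N_C · m`, `ℓ ∤ m`): `3 ∣ c_ℓ(C) ↔ 3 ∣ c_ℓ(G)`.  Mechanism: `C(ℚ_ℓ)[3] ≅ Φ_ℓ(𝔽_ℓ)[3]` (the identity component
is a pro-ℓ extension of an ℓ-group, uniquely 3-divisible) and `h⁰(ℚ_ℓ, ρ̄)` is a `ρ̄`-invariant.  Why it might fail:
only through the identification `3 ∣ c_ℓ ⟺ Φ_ℓ(𝔽_ℓ)[3] ≠ 0` in a non-cyclic `Φ` (type I₀*, `Φ ⊆ (ℤ/2)²`: no 3-torsion,
consistent) — none seen. Nothing asserted. [folklore] -/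
def AdditiveTamagawaThreeInvariant : Prop :=
  ∀ (C G : WeierstrassCurve ℚ) [C.IsElliptic] [C.IsGloballyMinimal] [G.IsElliptic] [G.IsGloballyMinimal]
    (ℓ m : ℕ) (hℓ : ℓ.Prime),
    C.HasIrreducibleModPGaloisRep 3 → IsCongruentModThree C G → (ClassO5 C 3 ∨ ¬ Addv C 3) → ℓ ≠ 3 →
    G.conductorNorm ℤ = C.conductorNorm ℤ * m → ¬ (ℓ ∣ m) →
    C.HasAdditiveReductionAt (placeOfNatPrime ℓ hℓ) →
    (Literature.NumberTheory.EllipticCurves.KunduRay2024.PDvdTamagawaAt C 3 ℓ ↔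
      Literature.NumberTheory.EllipticCurves.KunduRay2024.PDvdTamagawaAt G 3 ℓ)

/-- **`AdditiveLocalRootNumberCongruenceInvariant`** (THEOREM-CANDIDATE at `ℓ ≥ 5` via Rohrlich's formulae and the
mod-3 invariance of the prime-to-3 part of the inertia image; GENUINE CONJECTURE at `ℓ = 2`; EVIDENCE: JPC3-CAL/A,
`w_ℓ(C) = w_ℓ(G)` at 103 546/103 546 shared additive primes, 51 596 of them `ℓ = 2`, 3 538 of them with `c_ℓ = 3`).
Same hypotheses: the local root numbers at the additive place agree.  Consequence used by the transfer law: an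
additive prime is never a signed transfer place.  Why it might fail: at `ℓ = 2` two congruent curves with
`H¹(ℚ₂, ρ̄) = 0` could a priori differ in `w₂` (parity would then have to be balanced at another additive place of
the same pair). Nothing asserted. [cite: Rohrlich1994CRM, §19–20] -/
@[conjecture] def AdditiveLocalRootNumberCongruenceInvariant : Prop :=
  ∀ (C G : WeierstrassCurve ℚ) [C.IsElliptic] [C.IsGloballyMinimal] [G.IsElliptic] [G.IsGloballyMinimal]
    (ℓ m : ℕ) (hℓ : ℓ.Prime),
    C.HasIrreducibleModPGaloisRep 3 → IsCongruentModThree C G → (ClassO5 C 3 ∨ ¬ Addv C 3) → ℓ ≠ 3 →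
    G.conductorNorm ℤ = C.conductorNorm ℤ * m → ¬ (ℓ ∣ m) →
    C.HasAdditiveReductionAt (placeOfNatPrime ℓ hℓ) →
    C.localRootNumberAt (placeOfNatPrime ℓ hℓ) = G.localRootNumberAt (placeOfNatPrime ℓ hℓ)

/-- **`AdditivePlacesFreeTransferThree`** (THEOREM-CANDIDATE; EVIDENCE: JPC3-CAL/A sub-stratum A3w0 with one split
sharp-type new prime, 1 352 singleton + 3 set verdicts, 0 exceptions: rank 0 ⟹ +1 450/450; rank 1 with the
generator 3-divisible in `C(ℚ_q)` ⟹ +1 415/415 (seven of them `G` of rank 0 with `9 ∣ #Ш_an(G)`); rank 1 not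
divisible ⟹ −1 366/366; rank 2 ⟹ −1 110/110; and the A0 rows, 66 235 + 1 039).  The signed level-raising law
`SignedLevelRaisingTransferThreeSharp` with its hypothesis "no 3-transverse prime" RELAXED to: every prime `ℓ ≠ q`
with `3 ∣ c_ℓ` on either side is an ADDITIVE prime of `C` — additive places, even with `c_ℓ = 3`, are free (their
Kummer lines in `H¹(ℚ_ℓ, ρ̄)` coincide).  Why it might fail: a pair of congruent curves of types IV / IV* at `ℓ`
whose 1-dimensional local conditions differ (it would show as `|Δ| = 2` at `k = 1`, or `Δ = −1` at rank 0; none in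
3 509 rows). Nothing asserted. [cite: WZhang2014, Lemma 4.2 (p. 217)] -/
@[conjecture] def AdditivePlacesFreeTransferThree : Prop :=
  ∀ (C G : WeierstrassCurve ℚ) [C.IsElliptic] [C.IsGloballyMinimal] [G.IsElliptic] [G.IsGloballyMinimal]
    (q : ℕ) (hq : q.Prime),
    C.HasIrreducibleModPGaloisRep 3 → IsCongruentModThree C G → (ClassO5 C 3 ∨ ¬ Addv C 3) →
    q ≠ 3 → ¬ @FullLocalThreeTorsionAt C q ⟨hq⟩ →
    ¬ (q ∣ C.conductorNorm ℤ) → G.conductorNorm ℤ = C.conductorNorm ℤ * q → @IsSplitNodeAt G q ⟨hq⟩ →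
    (∀ ℓ ∈ transversePrimesThree C ∪ (transversePrimesThree G \ {q}), ∃ hℓ : ℓ.Prime,
        C.HasAdditiveReductionAt (placeOfNatPrime ℓ hℓ)) →
    @NoLocalThreeTorsionAt C 3 ⟨Nat.prime_three⟩ → @NoLocalThreeTorsionAt G 3 ⟨Nat.prime_three⟩ →
    C.rootNumberThree = G.rootNumberThree →
    C.ShaFinite → ¬ (3 ∣ C.shaOrder) →
      (¬ @LocallyThreeDivisibleAt C q ⟨hq⟩ → selmerDimThree G + 1 = selmerDimThree C) ∧
      (@LocallyThreeDivisibleAt C q ⟨hq⟩ → selmerDimThree G = selmerDimThree C + 1)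

/-- **`AdditivePlacesFreeNonsplitThree`** (THEOREM-CANDIDATE; EVIDENCE: JPC3-CAL/A A3w0 with one NON-split new prime,
`dim Sel₃(G) = dim Sel₃(C)` 1 441/1 441: rank 1 876, rank 0 368, rank 2 197).  Level raising at one non-split prime
changes nothing even in the presence of shared additive primes with `c_ℓ = 3`. Nothing asserted.
[cite: WZhang2014, Lemma 4.2 (p. 217)] -/
@[conjecture] def AdditivePlacesFreeNonsplitThree : Prop :=
  ∀ (C G : WeierstrassCurve ℚ) [C.IsElliptic] [C.IsGloballyMinimal] [G.IsElliptic] [G.IsGloballyMinimal]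
    (q : ℕ) (hq : q.Prime),
    C.HasIrreducibleModPGaloisRep 3 → IsCongruentModThree C G → (ClassO5 C 3 ∨ ¬ Addv C 3) →
    q ≠ 3 → ¬ (q ∣ C.conductorNorm ℤ) → G.conductorNorm ℤ = C.conductorNorm ℤ * q → @IsNonsplitNodeAt G q ⟨hq⟩ →
    (∀ ℓ ∈ transversePrimesThree C ∪ (transversePrimesThree G \ {q}), ∃ hℓ : ℓ.Prime,
        C.HasAdditiveReductionAt (placeOfNatPrime ℓ hℓ)) →
    @NoLocalThreeTorsionAt C 3 ⟨Nat.prime_three⟩ → @NoLocalThreeTorsionAt G 3 ⟨Nat.prime_three⟩ →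
    C.ShaFinite → ¬ (3 ∣ C.shaOrder) →
      selmerDimThree G = selmerDimThree C

/-! ## §6′ Proved bookkeeping (cc-typer-5 GEN 14): the relaxation specialises back to the sharp law -/

/-- **PROVED edge.**  `AdditivePlacesFreeTransferThree → SignedLevelRaisingTransferThreeSharp`: under the sharp law's
hypotheses `transversePrimesThree C = ∅` and `transversePrimesThree G ⊆ {q}` the set
`transversePrimesThree C ∪ (transversePrimesThree G \ {q})` is empty, so the additivity hypothesis of the relaxed law is
vacuous and the two conclusions coincide verbatim. [folklore] -/
theorem signedLevelRaisingTransferThreeSharp_of_additivePlacesFree (h : AdditivePlacesFreeTransferThree) :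
    SignedLevelRaisingTransferThreeSharp := by
  intro C G _ _ _ _ q hq hirr hcong hcls hq3 hfull hqN hN hsplit hTC hTG h0C h0G hw hfin h3
  refine h C G q hq hirr hcong hcls hq3 hfull hqN hN hsplit ?_ h0C h0G hw hfin h3
  intro ℓ hℓ
  exfalso
  rcases hℓ with hℓC | hℓG
  · rw [hTC] at hℓC
    exact hℓC
  · have hq' : ℓ ∈ ({q} : Set ℕ) := hTG hℓG.1
    exact hℓG.2 hq'

end Summit.BirchSwinnertonDyer.Rank1Residual.O5

end
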